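import Literature.Computability.Cryptography.LWESwitchSamplingForm
import Literature.Probability.Distributions.PseudoGaussianSamplerParams
import Literature.Computability.Cryptography.RegevBDDToLWESample
import HarnessLib

/-!
# Rounding a jittered Gaussian at finite precision: the machine's version of the continuous part of one switched sample

Topic `Computability/Cryptography` (LWE), grouping namespace `BLPRS2013`; sequel of `LWESwitchSamplingForm.lean`
(`roundLaw c σ`: the law of `⌊c + q'u/Q + q'w⌉ mod q'`, `u ← U[-½,½)`, `w ← D_σ` — the one continuous ingredient of the
sampling form `samplingPMF` of the modulus switch). A coin-driven machine cannot draw `u` or `w`: it draws `P` fair bits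
for the jitter (the midpoint `û` of one of `2ᴾ` cells of `[-½,½)`), an integer `G` from the pseudo-Gaussian sampler
(`PGParams.lawPMF`, within `8·2^{-m}` of the rounded Gaussian `gaussBoxPMF b` = law of `round(2ᵇg)`, `g ← 𝒩(0,½)`,
`PseudoGaussianSamplerParams.lean`), and multiplies by a RATIONAL approximation `κ̂` of the irrational scale
`κ = q'σ/√π` (so that `q'w ≐ κg`). This file bounds the price in statistical distance. The analysis COUPLES the machine
with the ideal draw through `(u, g)`: `û = gridMid P u`, `G = round(2ᵇ g)`; the two rounded values differ only if the
ideal unrounded value is within the perturbation `Δ_g = (q'/Q)2^{-(P+1)} + |κ̂|2^{-(b+1)} + |κ̂ - κ|·|g|` of a half-integer,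
and — conditioning on `g` and using the jitter `u` for smoothing — that has probability `≤ (s + 4)·2Δ_g/s`, `s = q'/Q`:

* `gridMid P u` (`|gridMid P u - u| ≤ 2^{-(P+1)}`), `exists_abs_sub_half_le_of_round_ne` (if `round x ≠ round y` some
  half-integer lies within `|x - y|` of `x`), **`volume_near_halfInt_le`** (the jitter is near a half-integer of the
  affine image with probability `≤ (s + 2Δ + 2)·2Δ/s`; capped form `volume_near_halfInt_le'`: `≤ (s + 4)·2Δ/s`);
* `tvDist_toPMF_map_le_measureReal_ne` — **coupling**: two push-forwards of one probability measure are within the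
  probability that the maps differ;
* `idealRound`, `machRound` (the two rounded values as functions of `(u, g)`), `baseUG = U[-½,½) ⊗ 𝒩(0,½)`,
  **`measureReal_round_ne_le`** (`Pr[machRound ≠ idealRound] ≤ (s+4)(2/s)(δ₀ + (3/2)δ₁)`, `δ₀ = s·2^{-(P+1)} + |κ̂|2^{-(b+1)}`,
  `δ₁ = |κ̂ - κ|`; the Gaussian enters through `E[1 + g²] = 3/2`), and the `PMF` form **`tvDist_machRoundLaw_idealRoundLaw_le`**.

The identification of the ideal side with `roundLaw` (`κ = q'σ/√π`) and of the machine side with coins (`û` from `P`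
bits, `G ← PGParams.lawPMF`) is the business of the program files; here everything is about the two laws on `ℤ`.

## References

* Z. Brakerski, A. Langlois, C. Peikert, O. Regev, D. Stehlé, *Classical hardness of learning with errors*, STOC 2013;
  arXiv:1306.0281, Lemma 2.3 / §5 ("one can sample efficiently … to within negligible statistical distance") and Cor. 3.2.
  [BrakerskiEtAl2013]
* C. Peikert, *Public-key cryptosystems from the worst-case shortest vector problem*, STOC 2009, full version p. 7
  ("we can efficiently sample … to within a suitable amount of precision"). [Peikert2009]
* O. Goldreich, *Foundations of Cryptography I*, CUP 2001, §3.2.1 (statistical distance; coupling bound). [Goldreich2001]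
-/

noncomputable section

open MeasureTheory ProbabilityTheory Literature.Probability.Distributions
open scoped Real ENNReal NNReal

namespace Literature.Computability.Cryptography

namespace BLPRS2013

/-! ### The dyadic jitter -/

/-- **The midpoint of the dyadic cell of `u`**: `gridMid P u = (⌊2ᴾ(u + ½)⌋ + ½)/2ᴾ - ½` — what `P` fair bits give when
`u ← U[-½,½)` (cell index uniform on `[0, 2ᴾ)`). [cite: Peikert2009, p. 7 ("a suitable amount of precision")] -/
def gridMid (P : ℕ) (u : ℝ) : ℝ := ((⌊(2 : ℝ) ^ P * (u + 1 / 2)⌋ : ℝ) + 1 / 2) / 2 ^ P - 1 / 2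

/-- The midpoint is within half a cell of `u`. [folklore] -/
theorem abs_gridMid_sub_le (P : ℕ) (u : ℝ) : |gridMid P u - u| ≤ 1 / 2 ^ (P + 1) := by
  have h2 : (0 : ℝ) < 2 ^ P := by positivity
  set a : ℝ := (2 : ℝ) ^ P * (u + 1 / 2) with ha
  have hfl := Int.floor_le a
  have hlt := Int.lt_floor_add_one a
  have hdiff : gridMid P u - u = (((⌊a⌋ : ℝ) + 1 / 2) - a) / 2 ^ P := by
    unfold gridMid
    rw [← ha]
    field_simp
    ring
  have hnum : |((⌊a⌋ : ℝ) + 1 / 2) - a| ≤ 1 / 2 := abs_le.2 ⟨by linarith, by linarith⟩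
  rw [hdiff, abs_div, abs_of_pos h2, pow_succ, div_le_div_iff₀ h2 (by positivity)]
  nlinarith

/-! ### Roundings that differ straddle a half-integer -/

/-- **If two reals round differently, a half-integer lies between them**, hence within `|x - y|` of `x`. [folklore] -/
theorem exists_abs_sub_half_le_of_round_ne {x y : ℝ} (h : round x ≠ round y) :
    ∃ m : ℤ, |x - ((m : ℝ) + 1 / 2)| ≤ |x - y| := by
  -- `round a = ⌊a + ½⌋`; different floors of `a ≤ b` force an integer `k` with `a + ½ < k ≤ b + ½`
  have key : ∀ {a b : ℝ}, a ≤ b → round a ≠ round b → ∃ m : ℤ, a < (m : ℝ) + 1 / 2 ∧ (m : ℝ) + 1 / 2 ≤ b := by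
    intro a b hab hne
    rw [round_eq, round_eq] at hne
    have hlt : ⌊a + 1 / 2⌋ < ⌊b + 1 / 2⌋ := lt_of_le_of_ne (Int.floor_le_floor (by linarith)) hne
    refine ⟨⌊b + 1 / 2⌋ - 1, ?_, ?_⟩
    · have := Int.floor_lt.1 hlt
      push_cast
      linarith
    · have := Int.floor_le (b + 1 / 2)
      push_cast
      linarith
  rcases le_total x y with hxy | hxy
  · obtain ⟨m, h1, h2⟩ := key hxy h
    exact ⟨m, by rw [abs_of_neg (by linarith), abs_of_nonpos (by linarith)]; linarith⟩
  · obtain ⟨m, h1, h2⟩ := key hxy (Ne.symm h)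
    exact ⟨m, by rw [abs_of_nonneg (by linarith), abs_of_nonneg (by linarith)]; linarith⟩

/-! ### The jitter is rarely near a half-integer -/

/-- **The jitter smooths the rounding**: for an affine map `u ↦ x₀ + s·u` (`s > 0`) of the jitter `u ∈ [-½,½)`, the set of
`u` whose image is within `Δ` of a half-integer has Lebesgue measure `≤ (s + 2Δ + 2)·(2Δ/s)` (at most `s + 2Δ + 2`
half-integers are within reach, each contributing an interval of length `2Δ/s`). [folklore] -/
theorem volume_near_halfInt_le {s : ℝ} (hs : 0 < s) (x₀ : ℝ) {Δ : ℝ} (hΔ : 0 ≤ Δ) :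
    volume {u : ℝ | u ∈ Set.Ico (-(1 / 2 : ℝ)) (1 / 2) ∧ ∃ m : ℤ, |x₀ + s * u - ((m : ℝ) + 1 / 2)| ≤ Δ} ≤
      ENNReal.ofReal ((s + 2 * Δ + 2) * (2 * Δ / s)) := by
  -- the reachable half-integers
  set A : ℝ := x₀ - s / 2 - Δ - 1 / 2 with hA
  set Bv : ℝ := x₀ + s / 2 + Δ - 1 / 2 with hB
  set M : Finset ℤ := Finset.Ico ⌊A⌋ (⌊Bv⌋ + 1) with hM
  set piece : ℤ → Set ℝ := fun m => Set.Icc ((((m : ℝ) + 1 / 2) - Δ - x₀) / s) ((((m : ℝ) + 1 / 2) + Δ - x₀) / s) with hpiece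
  have hcover : {u : ℝ | u ∈ Set.Ico (-(1 / 2 : ℝ)) (1 / 2) ∧ ∃ m : ℤ, |x₀ + s * u - ((m : ℝ) + 1 / 2)| ≤ Δ} ⊆ ⋃ m ∈ M, piece m := by
    rintro u ⟨⟨hu1, hu2⟩, m, hm⟩
    rw [abs_le] at hm
    simp only [Set.mem_iUnion, exists_prop]
    refine ⟨m, ?_, ?_⟩
    · rw [hM, Finset.mem_Ico]
      have hsu1 : s * (-(1 / 2)) ≤ s * u := mul_le_mul_of_nonneg_left hu1 hs.le
      have hsu2 : s * u < s * (1 / 2) := mul_lt_mul_of_pos_left hu2 hs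
      constructor
      · have hAm : A ≤ m := by rw [hA]; linarith [hm.2]
        have h1 : (⌊A⌋ : ℝ) ≤ m := (Int.floor_le A).trans hAm
        exact_mod_cast h1
      · have hmB : (m : ℝ) < Bv := by rw [hB]; linarith [hm.1]
        have h2 : m ≤ ⌊Bv⌋ := Int.le_floor.2 hmB.le
        omega
    · simp only [hpiece, Set.mem_Icc]
      rw [div_le_iff₀ hs, le_div_iff₀ hs]
      constructor <;> linarith [hm.1, hm.2]
  refine (measure_mono hcover).trans ((measure_biUnion_finset_le M piece).trans ?_)
  have hvol : ∀ m ∈ M, volume (piece m) ≤ ENNReal.ofReal (2 * Δ / s) := by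
    intro m _
    rw [hpiece, Real.volume_Icc]
    refine ENNReal.ofReal_le_ofReal (le_of_eq ?_)
    field_simp
    ring
  refine (Finset.sum_le_sum hvol).trans ?_
  rw [Finset.sum_const, nsmul_eq_mul]
  have hcard : ((M.card : ℕ) : ℝ) ≤ s + 2 * Δ + 2 := by
    rw [hM, Int.card_Ico]
    have h1 : ((⌊Bv⌋ + 1 - ⌊A⌋ : ℤ) : ℝ) ≤ s + 2 * Δ + 2 := by
      have hfB : (⌊Bv⌋ : ℝ) ≤ Bv := Int.floor_le Bv
      have hfA : A < (⌊A⌋ : ℝ) + 1 := Int.lt_floor_add_one A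
      push_cast
      rw [hA, hB] at *
      linarith
    have h0 : (0 : ℝ) ≤ s + 2 * Δ + 2 := by positivity
    rcases le_or_gt (⌊Bv⌋ + 1 - ⌊A⌋) 0 with hneg | hpos
    · rw [Int.toNat_of_nonpos hneg]; simpa using h0
    · have : (((⌊Bv⌋ + 1 - ⌊A⌋).toNat : ℕ) : ℝ) = ((⌊Bv⌋ + 1 - ⌊A⌋ : ℤ) : ℝ) := by
        rw [show (((⌊Bv⌋ + 1 - ⌊A⌋).toNat : ℕ) : ℝ) = (((⌊Bv⌋ + 1 - ⌊A⌋).toNat : ℤ) : ℝ) by norm_cast,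
          Int.toNat_of_nonneg hpos.le]
      rw [this]; exact h1
  calc (M.card : ℝ≥0∞) * ENNReal.ofReal (2 * Δ / s) = ENNReal.ofReal (M.card * (2 * Δ / s)) := by
        rw [ENNReal.ofReal_mul (Nat.cast_nonneg _), ENNReal.ofReal_natCast]
    _ ≤ ENNReal.ofReal ((s + 2 * Δ + 2) * (2 * Δ / s)) :=
        ENNReal.ofReal_le_ofReal (mul_le_mul_of_nonneg_right hcard (by positivity))

/-- The capped form: `≤ (s + 4)·(2Δ/s)` for every `Δ ≥ 0` (for `Δ ≤ 1` by the count, for `Δ > 1` because the jitter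
has total mass `1 ≤ (s+4)·2Δ/s`). [folklore] -/
theorem volume_near_halfInt_le' {s : ℝ} (hs : 0 < s) (x₀ : ℝ) {Δ : ℝ} (hΔ : 0 ≤ Δ) :
    volume {u : ℝ | u ∈ Set.Ico (-(1 / 2 : ℝ)) (1 / 2) ∧ ∃ m : ℤ, |x₀ + s * u - ((m : ℝ) + 1 / 2)| ≤ Δ} ≤
      ENNReal.ofReal ((s + 4) * (2 * Δ / s)) := by
  rcases le_or_gt Δ 1 with h1 | h1
  · refine (volume_near_halfInt_le hs x₀ hΔ).trans (ENNReal.ofReal_le_ofReal ?_)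
    exact mul_le_mul_of_nonneg_right (by linarith) (by positivity)
  · calc volume {u : ℝ | u ∈ Set.Ico (-(1 / 2 : ℝ)) (1 / 2) ∧ ∃ m : ℤ, |x₀ + s * u - ((m : ℝ) + 1 / 2)| ≤ Δ}
        ≤ volume (Set.Ico (-(1 / 2 : ℝ)) (1 / 2)) := measure_mono fun u hu => hu.1
      _ = 1 := by rw [Real.volume_Ico]; norm_num
      _ ≤ ENNReal.ofReal ((s + 4) * (2 * Δ / s)) := by
          rw [← ENNReal.ofReal_one]
          refine ENNReal.ofReal_le_ofReal ?_
          rw [mul_div_assoc', le_div_iff₀ hs]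
          nlinarith

/-! ### Coupling bound -/

/-- **Coupling**: two push-forwards of ONE probability measure along measurable maps into a countable space are within
the probability that the maps differ: `Δ((μ∘F⁻¹), (μ∘F₀⁻¹)) ≤ μ{F ≠ F₀}`. [cite: Goldreich2001, §3.2.1] -/
theorem tvDist_toPMF_map_le_measureReal_ne {α β : Type*} [MeasurableSpace α] [MeasurableSpace β] [Countable β]
    [MeasurableSingletonClass β] (μ : Measure α) [IsProbabilityMeasure μ] {F F₀ : α → β} (hF : Measurable F)
    (hF₀ : Measurable F₀) [IsProbabilityMeasure (μ.map F)] [IsProbabilityMeasure (μ.map F₀)] :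
    (μ.map F).toPMF.tvDist (μ.map F₀).toPMF ≤ μ.real {x | F x ≠ F₀ x} := by
  refine PMF.tvDist_toPMF_le_of_forall _ _ fun S hS => ?_
  rw [measureReal_def, measureReal_def, Measure.map_apply hF hS, Measure.map_apply hF₀ hS, ← measureReal_def,
    ← measureReal_def]
  have hsub : F ⁻¹' S ⊆ (F ⁻¹' S \ F₀ ⁻¹' S) ∪ F₀ ⁻¹' S := by
    intro x hx
    by_cases h : x ∈ F₀ ⁻¹' S
    · exact Or.inr h
    · exact Or.inl ⟨hx, h⟩
  have hdiff : F ⁻¹' S \ F₀ ⁻¹' S ⊆ {x | F x ≠ F₀ x} := by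
    rintro x ⟨h1, h2⟩ heq
    exact h2 (by rw [Set.mem_preimage, ← heq]; exact h1)
  have h1 : μ.real (F ⁻¹' S) ≤ μ.real (F ⁻¹' S \ F₀ ⁻¹' S) + μ.real (F₀ ⁻¹' S) :=
    (measureReal_mono hsub).trans (measureReal_union_le _ _)
  have h2 : μ.real (F ⁻¹' S \ F₀ ⁻¹' S) ≤ μ.real {x | F x ≠ F₀ x} := measureReal_mono hdiff
  linarith

/-! ### The two rounded values and the base measure -/

section Round

variable (Q q' : ℕ)

/-- `round` is measurable (private copy of the tree's `measurable_round_real`). [folklore] -/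
private theorem measurable_round' : Measurable (round : ℝ → ℤ) := by
  have : (round : ℝ → ℤ) = fun x => ⌊x + 1 / 2⌋ := funext round_eq
  rw [this]
  exact Int.measurable_floor.comp (measurable_id.add_const _)

/-- **The ideal rounded value** `⌊c + q'u/Q + κg⌉` as a function of `(u, g)`. [cite: BrakerskiEtAl2013, Cor. 3.2 (the rounding `⌊q'·⌉`)] -/
def idealRound (c κ : ℝ) (p : ℝ × ℝ) : ℤ := round (c + (q' : ℝ) * p.1 / Q + κ * p.2)

/-- **The machine's rounded value** `⌊c + q'û/Q + κ̂·round(2ᵇg)/2ᵇ⌉`, coupled to the ideal one through `(u, g)`.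
[cite: Peikert2009, p. 7 ("a suitable amount of precision")] -/
def machRound (c κh : ℝ) (b P : ℕ) (p : ℝ × ℝ) : ℤ :=
  round (c + (q' : ℝ) * gridMid P p.1 / Q + κh * ((round ((2 : ℝ) ^ b * p.2) : ℤ) : ℝ) / 2 ^ b)

/-- **The base measure**: jitter `u ← U[-½,½)` and standard Gaussian `g ← 𝒩(0,½)`, independent. [folklore] -/
def baseUG : Measure (ℝ × ℝ) := LWE.unitUniform.prod (gaussianReal 0 (1 / 2 : ℝ≥0))

/-- The base measure is a probability measure. [folklore] -/
instance isProbabilityMeasure_baseUG : IsProbabilityMeasure baseUG := by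
  unfold baseUG; infer_instance

/-- `gridMid` is measurable. [folklore] -/
theorem measurable_gridMid (P : ℕ) : Measurable (gridMid P) := by
  unfold gridMid
  refine ((Measurable.add_const ?_ _).div_const _).sub_const _
  exact (measurable_from_top (f := fun z : ℤ => (z : ℝ))).comp (Int.measurable_floor.comp ((measurable_const.mul measurable_id).comp
    (measurable_id.add_const _)))

/-- `idealRound` is measurable. [folklore] -/
theorem measurable_idealRound (c κ : ℝ) : Measurable (idealRound Q q' c κ) := by
  unfold idealRound
  exact measurable_round'.comp ((measurable_const.add ((measurable_fst.const_mul _).div_const _)).add (measurable_snd.const_mul _))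

/-- `machRound` is measurable. [folklore] -/
theorem measurable_machRound (c κh : ℝ) (b P : ℕ) : Measurable (machRound Q q' c κh b P) := by
  unfold machRound
  refine measurable_round'.comp ((measurable_const.add ((((measurable_gridMid P).comp measurable_fst).const_mul _).div_const _)).add ?_)
  refine (Measurable.const_mul ?_ _).div_const _
  exact (measurable_from_top (f := fun z : ℤ => (z : ℝ))).comp (measurable_round'.comp (measurable_snd.const_mul _))

/-- `|g - round(2ᵇg)/2ᵇ| ≤ 2^{-(b+1)}` (a private twin of `QuantumComplexity.RoundedGaussianPermanent.abs_sub_round_div_le`,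
to spare the import). [folklore] -/
private theorem abs_sub_round_div_le (b : ℕ) (g : ℝ) : |g - ((round ((2 : ℝ) ^ b * g) : ℤ) : ℝ) / 2 ^ b| ≤ 1 / 2 ^ (b + 1) := by
  have h2 : (0 : ℝ) < 2 ^ b := by positivity
  have h := abs_sub_round ((2 : ℝ) ^ b * g)
  have hrew : g - ((round ((2 : ℝ) ^ b * g) : ℤ) : ℝ) / 2 ^ b = ((2 : ℝ) ^ b * g - (round ((2 : ℝ) ^ b * g) : ℝ)) / 2 ^ b := by
    field_simp
  rw [hrew, abs_div, abs_of_pos h2, pow_succ, div_le_div_iff₀ h2 (by positivity)]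
  nlinarith

/-- **The perturbation**: for every `(u, g)`, the machine's unrounded value is within
`Δ_g = (q'/Q)·2^{-(P+1)} + |κ̂|·2^{-(b+1)} + |κ̂ - κ|·|g|` of the ideal one. [folklore] -/
theorem abs_unrounded_sub_le (c κ κh : ℝ) (b P : ℕ) (u g : ℝ) :
    |(c + (q' : ℝ) * u / Q + κ * g) - (c + (q' : ℝ) * gridMid P u / Q + κh * ((round ((2 : ℝ) ^ b * g) : ℤ) : ℝ) / 2 ^ b)| ≤
      (q' : ℝ) / Q * (1 / 2 ^ (P + 1)) + |κh| * (1 / 2 ^ (b + 1)) + |κh - κ| * |g| := by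
  have hQ : (0 : ℝ) ≤ (q' : ℝ) / Q := by positivity
  have h1 := abs_gridMid_sub_le P u
  have h2 := abs_sub_round_div_le b g
  have hsplit : (c + (q' : ℝ) * u / Q + κ * g) - (c + (q' : ℝ) * gridMid P u / Q + κh * ((round ((2 : ℝ) ^ b * g) : ℤ) : ℝ) / 2 ^ b) =
      (q' : ℝ) / Q * (u - gridMid P u) + κh * (g - ((round ((2 : ℝ) ^ b * g) : ℤ) : ℝ) / 2 ^ b) + (κ - κh) * g := by ring
  rw [hsplit]
  calc |(q' : ℝ) / Q * (u - gridMid P u) + κh * (g - ((round ((2 : ℝ) ^ b * g) : ℤ) : ℝ) / 2 ^ b) + (κ - κh) * g|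
      ≤ |(q' : ℝ) / Q * (u - gridMid P u)| + |κh * (g - ((round ((2 : ℝ) ^ b * g) : ℤ) : ℝ) / 2 ^ b)| + |(κ - κh) * g| := abs_add_three _ _ _
    _ = (q' : ℝ) / Q * |u - gridMid P u| + |κh| * |g - ((round ((2 : ℝ) ^ b * g) : ℤ) : ℝ) / 2 ^ b| + |κh - κ| * |g| := by
        rw [abs_mul, abs_mul, abs_mul, abs_of_nonneg hQ, abs_sub_comm κ κh]
    _ ≤ (q' : ℝ) / Q * (1 / 2 ^ (P + 1)) + |κh| * (1 / 2 ^ (b + 1)) + |κh - κ| * |g| := by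
        gcongr
        rwa [abs_sub_comm] at h1

variable [NeZero Q] [NeZero q']

/-- **The section bound**: for a fixed `g`, the jitters `u` on which the two rounded values differ have probability
`≤ (s + 4)·(2Δ_g/s)`, `s = q'/Q`. [cite: Peikert2009, p. 7; Goldreich2001, §3.2.1] -/
theorem unitUniform_round_ne_le (c κ κh : ℝ) (b P : ℕ) (g : ℝ) :
    LWE.unitUniform {u : ℝ | machRound Q q' c κh b P (u, g) ≠ idealRound Q q' c κ (u, g)} ≤
      ENNReal.ofReal (((q' : ℝ) / Q + 4) * (2 * ((q' : ℝ) / Q * (1 / 2 ^ (P + 1)) + |κh| * (1 / 2 ^ (b + 1)) + |κh - κ| * |g|) /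
        ((q' : ℝ) / Q))) := by
  have hs : (0 : ℝ) < (q' : ℝ) / Q := by
    have : (0 : ℝ) < q' := by exact_mod_cast Nat.pos_of_ne_zero (NeZero.ne q')
    have : (0 : ℝ) < Q := by exact_mod_cast Nat.pos_of_ne_zero (NeZero.ne Q)
    positivity
  set Δ : ℝ := (q' : ℝ) / Q * (1 / 2 ^ (P + 1)) + |κh| * (1 / 2 ^ (b + 1)) + |κh - κ| * |g| with hΔ
  have hΔ0 : 0 ≤ Δ := by rw [hΔ]; positivity
  have hsub : {u : ℝ | machRound Q q' c κh b P (u, g) ≠ idealRound Q q' c κ (u, g)} ∩ Set.Ico (-(1 / 2 : ℝ)) (1 / 2) ⊆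
      {u : ℝ | u ∈ Set.Ico (-(1 / 2 : ℝ)) (1 / 2) ∧ ∃ m : ℤ, |(c + κ * g) + (q' : ℝ) / Q * u - ((m : ℝ) + 1 / 2)| ≤ Δ} := by
    rintro u ⟨hne, hu⟩
    refine ⟨hu, ?_⟩
    obtain ⟨m, hm⟩ := exists_abs_sub_half_le_of_round_ne (Ne.symm hne)
    refine ⟨m, ?_⟩
    have hx : (c + κ * g) + (q' : ℝ) / Q * u = c + (q' : ℝ) * u / Q + κ * g := by ring
    rw [hx]
    exact hm.trans (abs_unrounded_sub_le Q q' c κ κh b P u g)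
  rw [LWE.unitUniform, Measure.restrict_apply' measurableSet_Ico]
  exact (measure_mono hsub).trans (volume_near_halfInt_le' hs (c + κ * g) hΔ0)

/-- `∫ (1 + g²) d𝒩(0,½) = 3/2`. [folklore] -/
theorem integral_one_add_sq_gaussianHalf : ∫ g, (1 + g ^ 2) ∂gaussianReal 0 (1 / 2 : ℝ≥0) = 3 / 2 := by
  have hint : Integrable (fun g : ℝ => g ^ 2) (gaussianReal 0 (1 / 2 : ℝ≥0)) :=
    (memLp_two_iff_integrable_sq measurable_id.aestronglyMeasurable).1 (memLp_id_gaussianReal 2)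
  rw [integral_add (integrable_const _) hint, integral_const, probReal_univ, one_smul]
  have hvar := variance_id_gaussianReal (μ := (0 : ℝ)) (v := (1 / 2 : ℝ≥0))
  rw [variance_eq_integral measurable_id.aemeasurable] at hvar
  simp only [id_eq, integral_id_gaussianReal, sub_zero] at hvar
  rw [hvar]
  norm_num

/-- `|g| ≤ 1 + g²` (a private twin of `Probability.Process.abs_le_one_add_sq`, to spare the import). [folklore] -/
private theorem abs_le_one_add_sq (g : ℝ) : |g| ≤ 1 + g ^ 2 := by
  rcases le_or_gt |g| 1 with h | h
  · nlinarith [sq_nonneg g]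
  · have : |g| ≤ |g| ^ 2 := by nlinarith
    rw [sq_abs] at this
    linarith

/-- **The coupling event is rare**: `Pr_{(u,g)}[machRound ≠ idealRound] ≤ (s+4)(2/s)(δ₀ + (3/2)δ₁)`, `s = q'/Q`,
`δ₀ = s·2^{-(P+1)} + |κ̂|·2^{-(b+1)}`, `δ₁ = |κ̂ - κ|`. [cite: Peikert2009, p. 7; Goldreich2001, §3.2.1] -/
theorem measureReal_round_ne_le (c κ κh : ℝ) (b P : ℕ) :
    baseUG.real {p : ℝ × ℝ | machRound Q q' c κh b P p ≠ idealRound Q q' c κ p} ≤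
      ((q' : ℝ) / Q + 4) * (2 / ((q' : ℝ) / Q)) *
        (((q' : ℝ) / Q * (1 / 2 ^ (P + 1)) + |κh| * (1 / 2 ^ (b + 1))) + 3 / 2 * |κh - κ|) := by
  have hs : (0 : ℝ) < (q' : ℝ) / Q := by
    have : (0 : ℝ) < q' := by exact_mod_cast Nat.pos_of_ne_zero (NeZero.ne q')
    have : (0 : ℝ) < Q := by exact_mod_cast Nat.pos_of_ne_zero (NeZero.ne Q)
    positivity
  set s : ℝ := (q' : ℝ) / Q with hsdef
  set δ₀ : ℝ := s * (1 / 2 ^ (P + 1)) + |κh| * (1 / 2 ^ (b + 1)) with hδ₀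
  set δ₁ : ℝ := |κh - κ| with hδ₁
  have hδ₀0 : 0 ≤ δ₀ := by rw [hδ₀]; positivity
  have hδ₁0 : 0 ≤ δ₁ := abs_nonneg _
  set E : Set (ℝ × ℝ) := {p : ℝ × ℝ | machRound Q q' c κh b P p ≠ idealRound Q q' c κ p} with hE
  have hEm : MeasurableSet E := by
    have hpair : Measurable fun p : ℝ × ℝ => (machRound Q q' c κh b P p, idealRound Q q' c κ p) :=
      (measurable_machRound Q q' c κh b P).prodMk (measurable_idealRound Q q' c κ)
    exact hpair (Set.to_countable {q : ℤ × ℤ | q.1 ≠ q.2}).measurableSet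
  have hint : Integrable (fun g : ℝ => g ^ 2) (gaussianReal 0 (1 / 2 : ℝ≥0)) :=
    (memLp_two_iff_integrable_sq measurable_id.aestronglyMeasurable).1 (memLp_id_gaussianReal 2)
  set K : ℝ := (s + 4) * (2 / s) with hK
  have hK0 : 0 ≤ K := by rw [hK]; positivity
  -- disintegrate along `g`
  have hdis : baseUG E = ∫⁻ g, LWE.unitUniform {u : ℝ | machRound Q q' c κh b P (u, g) ≠ idealRound Q q' c κ (u, g)}
      ∂gaussianReal 0 (1 / 2 : ℝ≥0) := by
    rw [baseUG, Measure.prod_apply_symm hEm]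
    rfl
  -- bound each section, then integrate `δ₀ + δ₁|g| ≤ δ₀ + δ₁(1 + g²)`
  have hsec : ∀ g : ℝ, LWE.unitUniform {u : ℝ | machRound Q q' c κh b P (u, g) ≠ idealRound Q q' c κ (u, g)} ≤
      ENNReal.ofReal (K * (δ₀ + δ₁ * (1 + g ^ 2))) := by
    intro g
    refine (unitUniform_round_ne_le Q q' c κ κh b P g).trans (ENNReal.ofReal_le_ofReal ?_)
    rw [← hsdef, ← hδ₁]
    have hg := abs_le_one_add_sq g
    have h1 : δ₁ * |g| ≤ δ₁ * (1 + g ^ 2) := mul_le_mul_of_nonneg_left hg hδ₁0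
    rw [show (s + 4) * (2 * (s * (1 / 2 ^ (P + 1)) + |κh| * (1 / 2 ^ (b + 1)) + δ₁ * |g|) / s) =
      K * (δ₀ + δ₁ * |g|) by rw [hK, hδ₀]; field_simp]
    exact mul_le_mul_of_nonneg_left (by linarith) hK0
  have hfi : Integrable (fun g : ℝ => K * (δ₀ + δ₁ * (1 + g ^ 2))) (gaussianReal 0 (1 / 2 : ℝ≥0)) :=
    ((integrable_const δ₀).add (((integrable_const (1 : ℝ)).add hint).const_mul δ₁)).const_mul K
  have hnn : 0 ≤ᵐ[gaussianReal 0 (1 / 2 : ℝ≥0)] fun g : ℝ => K * (δ₀ + δ₁ * (1 + g ^ 2)) :=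
    Filter.Eventually.of_forall fun g => by positivity
  have hI2 : Integrable (fun g : ℝ => δ₁ * (1 + g ^ 2)) (gaussianReal 0 (1 / 2 : ℝ≥0)) :=
    ((integrable_const (1 : ℝ)).add hint).const_mul δ₁
  have hval : ∫ g, K * (δ₀ + δ₁ * (1 + g ^ 2)) ∂gaussianReal 0 (1 / 2 : ℝ≥0) = K * (δ₀ + 3 / 2 * δ₁) := by
    rw [integral_const_mul, integral_add (integrable_const _) hI2, integral_const, probReal_univ, one_smul,
      integral_const_mul, integral_one_add_sq_gaussianHalf]
    ring
  have hbound : baseUG E ≤ ENNReal.ofReal (K * (δ₀ + 3 / 2 * δ₁)) := by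
    rw [hdis]
    calc ∫⁻ g, LWE.unitUniform {u : ℝ | machRound Q q' c κh b P (u, g) ≠ idealRound Q q' c κ (u, g)} ∂gaussianReal 0 (1 / 2 : ℝ≥0)
        ≤ ∫⁻ g, ENNReal.ofReal (K * (δ₀ + δ₁ * (1 + g ^ 2))) ∂gaussianReal 0 (1 / 2 : ℝ≥0) := lintegral_mono hsec
      _ = ENNReal.ofReal (∫ g, K * (δ₀ + δ₁ * (1 + g ^ 2)) ∂gaussianReal 0 (1 / 2 : ℝ≥0)) :=
          (ofReal_integral_eq_lintegral_ofReal hfi hnn).symm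
      _ = ENNReal.ofReal (K * (δ₀ + 3 / 2 * δ₁)) := by rw [hval]
  rw [measureReal_def]
  exact ENNReal.toReal_le_of_le_ofReal (by positivity) hbound

/-- **The ideal rounded law** (`PMF` on `ℤ`). [cite: BrakerskiEtAl2013, Cor. 3.2] -/
def idealRoundLaw (c κ : ℝ) : PMF ℤ :=
  haveI : IsProbabilityMeasure (baseUG.map (idealRound Q q' c κ)) :=
    Measure.isProbabilityMeasure_map (measurable_idealRound Q q' c κ).aemeasurable
  (baseUG.map (idealRound Q q' c κ)).toPMF

/-- **The machine's rounded law** (`PMF` on `ℤ`; coupled form — its coin description is in the program files).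
[cite: Peikert2009, p. 7] -/
def machRoundLaw (c κh : ℝ) (b P : ℕ) : PMF ℤ :=
  haveI : IsProbabilityMeasure (baseUG.map (machRound Q q' c κh b P)) :=
    Measure.isProbabilityMeasure_map (measurable_machRound Q q' c κh b P).aemeasurable
  (baseUG.map (machRound Q q' c κh b P)).toPMF

/-- **Finite precision costs little**: `Δ(machRoundLaw, idealRoundLaw) ≤ (s+4)(2/s)(δ₀ + (3/2)δ₁)`, `s = q'/Q`,
`δ₀ = s·2^{-(P+1)} + |κ̂|·2^{-(b+1)}`, `δ₁ = |κ̂ - κ|`. [cite: Peikert2009, p. 7; Goldreich2001, §3.2.1] -/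
theorem tvDist_machRoundLaw_idealRoundLaw_le (c κ κh : ℝ) (b P : ℕ) :
    (machRoundLaw Q q' c κh b P).tvDist (idealRoundLaw Q q' c κ) ≤
      ((q' : ℝ) / Q + 4) * (2 / ((q' : ℝ) / Q)) *
        (((q' : ℝ) / Q * (1 / 2 ^ (P + 1)) + |κh| * (1 / 2 ^ (b + 1))) + 3 / 2 * |κh - κ|) := by
  haveI : IsProbabilityMeasure (baseUG.map (idealRound Q q' c κ)) :=
    Measure.isProbabilityMeasure_map (measurable_idealRound Q q' c κ).aemeasurable
  haveI : IsProbabilityMeasure (baseUG.map (machRound Q q' c κh b P)) :=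
    Measure.isProbabilityMeasure_map (measurable_machRound Q q' c κh b P).aemeasurable
  exact (tvDist_toPMF_map_le_measureReal_ne baseUG (measurable_machRound Q q' c κh b P) (measurable_idealRound Q q' c κ)).trans
    (measureReal_round_ne_le Q q' c κ κh b P)

end Round

end BLPRS2013

end Literature.Computability.Cryptography

end
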